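import Literature.NumberTheory.Automorphic.TorusIntegrandThinSupport
import Literature.NumberTheory.Automorphic.ArchRankinSelbergPairBridge

/-!
# Crux `PairLBoundaryJS` (stmt-Langlands-13622), line `Sketch` — stub `stub_unitBox_translate_productForm` (W4a),
# part 1: peeling the thin places, and the support collapse for the translate

Summit `Langlands`, sub-problem `Langlands`, helper file under `Theorems/` supporting the crux
`PairLBoundaryJS` (Arthur–Clozel (1989), Ch. 3, (2.2)), line `Sketch`, registered stub
`stub_unitBox_translate_productForm` (proved in `…PairLBoundaryJSUnitBoxTranslateProductForm`, which imports this file);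
this file proves the registered sub-goal `stub_unitBox_translate_collapse` (part (i) of that stub).

Bookkeeping on `GL_{n+1}(𝔸_K)` for the bad-place step of the Rankin–Selberg method for a pair
(Jacquet–Piatetski-Shapiro–Shalika (1983), (2.7); Cogdell (2004), §4.1, `Ψ = ∏_v Ψ_v`):

* `localComponent_*` — the `v`-component of `(h, 1)`, `(1, g_f)`, `ι_v(x)`, products;
* `pair_eq_prod_mul_pair` — **peeling the places of `S ⊆ T` off a product `W(g) W̄'(g)`**: if at every `v ∈ T`
  the value `W(g' ι_v(x)) W̄'(g' ι_v(x))` at a base point `g'` with trivial `v`-component and a local `x` with last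
  row `≡ e_{n+1} (mod 𝔭_v^m)` is `J_v(x) W(g') W̄'(g')`, then `W(g) W̄'(g) = (∏_{v ∈ S} J_v(g_v)) W(g') W̄'(g')` for
  `g'` obtained from `g` by stripping the `S`-components, up to right `K_f(𝔫)`-invariance off `T` (induction on
  `S`; `K(𝔫)` is defined place by place, `mem_principalCongruenceLevel_iff_forall_toLocal`);
* `setIntegral_translate_thin_eq_unitBox_univ` — **part (i) of the stub**: the thin pair integrand of the
  TRANSLATE `W(diag τ ·)` over `B({v ∉ T}) × K` equals its integral over `B(all) × K` (`diag τ diag a k = diag(τ a) k`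
  with the same last row since `lastEntry τ = 1`; the tree's `valued_eq_one_of_torusIntegrand_thin_ne_zero` at the
  torus point `(τ a, k)`, and `τ_v = 1` at `v ∈ T`);
* `prod_eq_zero_or_one`, `idealRadius_prod_pow_le` — small arithmetic for the level `𝔪 = ∏_{v ∈ T} 𝔭_v^m`.

All proofs complete; tree theorems only.

## References

* H. Jacquet, I. I. Piatetski-Shapiro, J. A. Shalika, *Rankin–Selberg convolutions*, Amer. J. Math.
  105 (1983), §2, (2.7) [JacquetPiatetskiShapiroShalika1983].
* J. W. Cogdell, *Analytic theory of L-functions for GL_n*, in *An Introduction to the Langlands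
  Program* (2004), §2.3, §4.1 [CogdellAnalyticTheory2004].
-/

noncomputable section

-- `Summit.Langlands.Langlands.…` (summit = sub-problem name, D-0017 layout) trips `dupNamespace`
set_option linter.dupNamespace false

open scoped MatrixGroups Topology Pointwise ENNReal NNReal ComplexConjugate InnerProductSpace ContDiff
-- the place subtypes indexing `mixedSpace K` are `Fintype` classically (`NormedCommRing (mixedSpace K)`)
open scoped Classical Matrix.Norms.Operator
open NumberField IsDedekindDomain MeasureTheory Measure Matrix Set Filter WithZero
open NumberField.mixedEmbedding
open Literature.NumberTheory.Automorphic AdelicGroupData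
open Literature.NumberTheory.GaloisRepresentations (ideleGroup HeckeCharacter)
open ValuativeRel

-- no local instances: the measurable structures of `setIntegral_translate_thin_eq_unitBox_univ` are hypotheses

namespace Summit.Langlands.Langlands.Theorems.UnitBoxTranslateProductForm

/-! ### Local components: glue -/

section Glue

variable {N : ℕ} {K : Type} [Field K] [NumberField K]

/-- `(h, 1) ∈ GL_N(𝔸_K)` has trivial `v`-component. [folklore] -/
theorem localComponent_ofInfinite (v : HeightOneSpectrum (𝓞 K)) (h : GL (Fin N) (mixedSpace K)) :
    localComponent v (GLn.ofInfinite N K h) = 1 := by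
  refine Units.ext (Matrix.ext fun i j => ?_)
  change AdelicGroupData.adeleEval K v ((GLn.ofInfinite N K h : Matrix (Fin N) (Fin N) (AdeleRing (𝓞 K) K)) i j) =
    (1 : Matrix (Fin N) (Fin N) (v.adicCompletion K)) i j
  rw [GLn.coe_ofInfinite_apply, AdelicGroupData.adeleEval_apply, Matrix.one_apply, Matrix.one_apply]
  split_ifs <;> rfl

/-- The `v`-component of `g` is that of its finite part `(1, g_f)`. [folklore] -/
theorem localComponent_ofFinite_sndHom (v : HeightOneSpectrum (𝓞 K)) (g : GL (Fin N) (AdeleRing (𝓞 K) K)) :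
    localComponent v (GLn.ofFinite N K (GLn.sndHom N K g)) = localComponent v g := by
  refine Matrix.GeneralLinearGroup.ext fun i j => ?_
  change ((Matrix.GeneralLinearGroup.map (AdelicGroupData.adeleEval K v) (GLn.ofFinite N K (GLn.sndHom N K g)) :
      GL (Fin N) (v.adicCompletion K)) : Matrix (Fin N) (Fin N) (v.adicCompletion K)) i j = _
  rw [coe_map_adeleEval_ofFinite_apply]
  rfl

/-- The `v`-component is multiplicative. [folklore] -/
theorem localComponent_mul (v : HeightOneSpectrum (𝓞 K)) (x y : GL (Fin N) (AdeleRing (𝓞 K) K)) :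
    localComponent v (x * y) = localComponent v x * localComponent v y :=
  map_mul _ x y

/-- The `v`-component of an inverse. [folklore] -/
theorem localComponent_inv (v : HeightOneSpectrum (𝓞 K)) (x : GL (Fin N) (AdeleRing (𝓞 K) K)) :
    localComponent v x⁻¹ = (localComponent v x)⁻¹ :=
  map_inv _ x

/-- The `v`-component of `1` is `1`. [folklore] -/
theorem localComponent_one (v : HeightOneSpectrum (𝓞 K)) :
    localComponent v (1 : GL (Fin N) (AdeleRing (𝓞 K) K)) = 1 :=
  map_one _

/-- `(ι_v x)_v = x`. [folklore] -/
theorem localComponent_ofLocal_self (v : HeightOneSpectrum (𝓞 K)) (x : GL (Fin N) (v.adicCompletion K)) :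
    localComponent v (GLn.ofLocal N K v x) = x :=
  GLn.toLocal_ofLocal x

/-- `(ι_v x)_w = 1` for `w ≠ v`. [folklore] -/
theorem localComponent_ofLocal_of_ne {v w : HeightOneSpectrum (𝓞 K)} (h : w ≠ v)
    (x : GL (Fin N) (v.adicCompletion K)) : localComponent w (GLn.ofLocal N K v x) = 1 :=
  GLn.toLocal_ofLocal_of_ne h x

end Glue

/-! ### Peeling the thin places -/

section Peel

variable {n : ℕ} {K : Type} [Field K] [NumberField K]

/-- **Peeling the places of `S ⊆ T` off a product `W W̄'`.** Let `W`, `W'` be right `K_f(𝔫)`-invariant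
with the primes of `𝔫` in `T`, and suppose that at every `v ∈ T` the value of `W(g' ι_v(x)) W̄'(g' ι_v(x))`
at a base point `g'` with trivial `v`-component and a local element `x` with last row `≡ e_{n+1} (mod 𝔭_v^m)`
is `J_v(x) W(g') W̄'(g')`. Then for `g`, `g'` with the same archimedean part, `g'` trivial at `S`, `g = g'`
at the places of `T` off `S`, `g'_w⁻¹ g_w ∈ GL_{n+1}(𝒪_w)` off `T`, and the last rows of `g_v`, `v ∈ S`,
`≡ e_{n+1} (mod 𝔭_v^m)`: `W(g) W̄'(g) = (∏_{v ∈ S} J_v(g_v)) W(g') W̄'(g')` (induction on `S`; the base case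
is right `K_f(𝔫)`-invariance, `K(𝔫)` being defined place by place). [folklore] -/
theorem pair_eq_prod_mul_pair {W W' : GL (Fin (n + 1)) (AdeleRing (𝓞 K) K) → ℂ} {𝔫 : Ideal (𝓞 K)} (h𝔫 : 𝔫 ≠ 0)
    (hWK : ∀ u ∈ finitePrincipalCongruenceLevel (n + 1) K 𝔫, ∀ g : GL (Fin (n + 1)) (AdeleRing (𝓞 K) K),
      W (g * GLn.ofFinite (n + 1) K u) = W g)
    (hW'K : ∀ u ∈ finitePrincipalCongruenceLevel (n + 1) K 𝔫, ∀ g : GL (Fin (n + 1)) (AdeleRing (𝓞 K) K),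
      W' (g * GLn.ofFinite (n + 1) K u) = W' g)
    {T : Finset (HeightOneSpectrum (𝓞 K))} (hT : ∀ w : HeightOneSpectrum (𝓞 K), w.asIdeal ∣ 𝔫 → w ∈ T) {m : ℕ}
    (J : (v : HeightOneSpectrum (𝓞 K)) → GL (Fin (n + 1)) (v.adicCompletion K) → ℂ)
    (hJ : ∀ v ∈ T, ∀ g' : GL (Fin (n + 1)) (AdeleRing (𝓞 K) K), localComponent v g' = 1 →
      ∀ x : GL (Fin (n + 1)) (v.adicCompletion K),
        (∀ j : Fin (n + 1), Valued.v ((x : Matrix (Fin (n + 1)) (Fin (n + 1)) (v.adicCompletion K)) (Fin.last n) j -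
          if j = Fin.last n then 1 else 0) ≤ exp (-(m : ℤ))) →
        W (g' * GLn.ofLocal (n + 1) K v x) * star (W' (g' * GLn.ofLocal (n + 1) K v x)) =
          J v x * (W g' * star (W' g'))) :
    ∀ S : Finset (HeightOneSpectrum (𝓞 K)), S ⊆ T → ∀ g g' : GL (Fin (n + 1)) (AdeleRing (𝓞 K) K),
      (∀ v ∈ S, localComponent v g' = 1) →
      (∀ w, w ∉ S → w ∈ T → localComponent w g = localComponent w g') →
      (∀ w, w ∉ T → (localComponent w g')⁻¹ * localComponent w g ∈
        valuedCongruenceSubgroup (Fin (n + 1)) (1 : ℤᵐ⁰)) →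
      GLn.fstHom (n + 1) K g = GLn.fstHom (n + 1) K g' →
      (∀ v ∈ S, ∀ j : Fin (n + 1),
        Valued.v (((localComponent v g : GL (Fin (n + 1)) (v.adicCompletion K)) :
            Matrix (Fin (n + 1)) (Fin (n + 1)) (v.adicCompletion K)) (Fin.last n) j -
          if j = Fin.last n then 1 else 0) ≤ exp (-(m : ℤ))) →
      W g * star (W' g) = (∏ v ∈ S, J v (localComponent v g)) * (W g' * star (W' g')) := by
  intro S
  induction S using Finset.induction_on with
  | empty =>
    intro _ g g' _ h2 h3 h4 _
    rw [Finset.prod_empty, one_mul]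
    -- `g'⁻¹ g ∈ K(𝔫)`, place by place
    have hu₀ : g'⁻¹ * g ∈ principalCongruenceLevel (n + 1) K 𝔫 := by
      rw [mem_principalCongruenceLevel_iff_forall_toLocal]
      refine ⟨by rw [map_mul, map_inv, h4, inv_mul_cancel], fun w => ?_⟩
      change localComponent w (g'⁻¹ * g) ∈ valuedCongruenceSubgroup (Fin (n + 1)) (idealRadius K w 𝔫)
      rw [localComponent_mul, localComponent_inv]
      by_cases hwT : w ∈ T
      · rw [h2 w (Finset.notMem_empty w) hwT, inv_mul_cancel]
        exact one_mem _
      · rw [idealRadius_eq_one_of_not_dvd h𝔫 (fun h => hwT (hT w h))]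
        exact h3 w hwT
    have hint : g'⁻¹ * g ∈ glIntegralLevel (n + 1) K := principalCongruenceLevel_le (n + 1) K 𝔫 hu₀
    have hof : GLn.ofFinite (n + 1) K (GLn.sndHom (n + 1) K (g'⁻¹ * g)) = g'⁻¹ * g :=
      GLn.ofFinite_sndHom_of_mem hint
    have hfin : GLn.sndHom (n + 1) K (g'⁻¹ * g) ∈ finitePrincipalCongruenceLevel (n + 1) K 𝔫 := by
      rw [mem_finitePrincipalCongruenceLevel_iff, hof]
      exact hu₀
    have hg : g = g' * GLn.ofFinite (n + 1) K (GLn.sndHom (n + 1) K (g'⁻¹ * g)) := by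
      rw [hof, mul_inv_cancel_left]
    rw [hg, hWK _ hfin, hW'K _ hfin]
  | insert v S hvS ih =>
    intro hST g g' h1 h2 h3 h4 h5
    have hvT : v ∈ T := hST (Finset.mem_insert_self v S)
    -- move the `v`-component of `g` onto the base point
    set g'' : GL (Fin (n + 1)) (AdeleRing (𝓞 K) K) := g' * GLn.ofLocal (n + 1) K v (localComponent v g) with hg''
    have hloc : ∀ w, localComponent w g'' =
        localComponent w g' * localComponent w (GLn.ofLocal (n + 1) K v (localComponent v g)) := fun w => by
      rw [hg'', localComponent_mul]
    have key := ih ((Finset.subset_insert v S).trans hST) g g'' ?_ ?_ ?_ ?_ ?_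
    · rw [key, Finset.prod_insert hvS, hg'', hJ v hvT g' (h1 v (Finset.mem_insert_self v S)) (localComponent v g)
        (h5 v (Finset.mem_insert_self v S))]
      ring
    · intro w hw
      have hwv : w ≠ v := fun h => hvS (h ▸ hw)
      rw [hloc, h1 w (Finset.mem_insert_of_mem hw), one_mul, localComponent_ofLocal_of_ne hwv]
    · intro w hwS hwT
      by_cases hwv : w = v
      · subst hwv
        rw [hloc, h1 w (Finset.mem_insert_self w S), one_mul, localComponent_ofLocal_self]
      · rw [hloc, localComponent_ofLocal_of_ne hwv, mul_one]
        exact h2 w (fun h => (Finset.mem_insert.1 h).elim hwv hwS) hwT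
    · intro w hwT
      have hwv : w ≠ v := fun h => hwT (h ▸ hvT)
      rw [hloc, localComponent_ofLocal_of_ne hwv, mul_one]
      exact h3 w hwT
    · rw [hg'', map_mul, GLn.fstHom_ofLocal, mul_one, h4]
    · exact fun w hw => h5 w (Finset.mem_insert_of_mem hw)

end Peel

/-! ### Part (i): the support collapse for the translate -/

section Collapse

variable {n : ℕ} {K : Type} [Field K] [NumberField K]
variable [MeasurableSpace (ideleGroup K)] [BorelSpace (ideleGroup K)]
  [MeasurableSpace (AdelicGroupData.gl (n + 1) K).Adelic]

/-- **Reduction of the thin `T`-integral of the TRANSLATED pair to the unit box at all finite places.**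
For `W` as in `setIntegral_torusPairIntegrandC_thin_eq_unitBox_univ` and a torus element `τ` with last entry
`1` and trivial components at the places of `T`, the pair integrand of `(W(diag τ ·), W₂, thinTestFun Φ_∞ T m)`
over `B({v ∉ T}) × K` equals its integral over `B(all) × K`: at a point `(a, k)` off the smaller box,
`W(diag τ diag a k) = W(diag(τ a) k)` and `e_{n+1} diag(τ a) k = e_{n+1} diag a k` (`lastEntry τ = 1`), so the
tree's `valued_eq_one_of_torusIntegrand_thin_ne_zero` at the torus point `(τ a, k)` gives `|τ_v a_v| = |a_v| = 1`
at `v ∈ T`. [folklore] -/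
theorem setIntegral_translate_thin_eq_unitBox_univ
    {ψ : AddChar (AdeleRing (𝓞 K) K) Circle} {W : GL (Fin (n + 1)) (AdeleRing (𝓞 K) K) → ℂ}
    (hWN : ∀ (u : ↥(adelicUnipotent (n + 1) K)) (g : GL (Fin (n + 1)) (AdeleRing (𝓞 K) K)),
      W ((u : GL (Fin (n + 1)) (AdeleRing (𝓞 K) K)) * g) = whittakerCharFun ψ u * W g)
    (hWZ : ∀ (z : ideleGroup K) (g : GL (Fin (n + 1)) (AdeleRing (𝓞 K) K)),
      ‖W (Matrix.GeneralLinearGroup.scalar (Fin (n + 1)) z * g)‖ = ‖W g‖)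
    {T : Finset (HeightOneSpectrum (𝓞 K))} {m : ℕ} (hm : 1 ≤ m)
    (τ : Fin (n + 1) → ideleGroup K) (hτ : lastEntry τ = 1)
    (hτT : ∀ v ∈ T, localComponent v (glDiagonal (n + 1) (AdeleRing (𝓞 K) K) τ) = 1)
    (hT : ∀ v ∈ T, ∃ (t : Fin (n + 1) → (v.adicCompletion K)ˣ) (M c₀ : ℤ),
      IsSpreadWhittakerAt v ψ t M W ∧
      (∃ x : v.adicCompletion K, Valued.v x ≤ exp (1 - c₀) ∧ ψ.adicComponent v x ≠ 1) ∧ 1 ≤ M ∧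
      (∀ i j : Fin (n + 1), i ≤ j → Valued.v (t j : v.adicCompletion K) ≤ Valued.v (t i : v.adicCompletion K)) ∧
      (∀ i j : Fin (n + 1), (i : ℕ) + 1 = j →
        exp (M - c₀) * Valued.v (t j : v.adicCompletion K) ≤ Valued.v (t i : v.adicCompletion K)) ∧
      exp (-(m : ℤ)) * Valued.v (t 0 : v.adicCompletion K) ≤
        exp (-M) * Valued.v (t (Fin.last n) : v.adicCompletion K))
    (W₂ : GL (Fin (n + 1)) (AdeleRing (𝓞 K) K) → ℂ) (Φinf : (Fin (n + 1) → InfiniteAdeleRing K) → ℝ) (s : ℂ)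
    (νA : Measure (Fin (n + 1) → ideleGroup K)) (νK : Measure ↥(maximalCompactAdelic (n + 1) K)) :
    ∫ p in unitBox {v | v ∉ (↑T : Set (HeightOneSpectrum (𝓞 K)))} ×ˢ Set.univ,
        torusPairIntegrandC (n + 1) K (fun g => W (glDiagonal (n + 1) (AdeleRing (𝓞 K) K) τ * g)) W₂
          (thinTestFun (n + 1) K Φinf T m) s p ∂(νA.prod νK) =
      ∫ p in unitBox (Set.univ : Set (HeightOneSpectrum (𝓞 K))) ×ˢ Set.univ,
        torusPairIntegrandC (n + 1) K (fun g => W (glDiagonal (n + 1) (AdeleRing (𝓞 K) K) τ * g)) W₂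
          (thinTestFun (n + 1) K Φinf T m) s p ∂(νA.prod νK) := by
  classical
  set S₁ : Set ((Fin (n + 1) → ideleGroup K) × ↥(maximalCompactAdelic (n + 1) K)) :=
    unitBox {v | v ∉ (↑T : Set (HeightOneSpectrum (𝓞 K)))} ×ˢ Set.univ with hS₁
  set S₂ : Set ((Fin (n + 1) → ideleGroup K) × ↥(maximalCompactAdelic (n + 1) K)) :=
    unitBox (Set.univ : Set (HeightOneSpectrum (𝓞 K))) ×ˢ Set.univ with hS₂
  have hsub : S₂ ⊆ S₁ := by
    rintro ⟨a, k⟩ ⟨ha, -⟩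
    exact ⟨fun w _ i => ha w (Set.mem_univ w) i, Set.mem_univ _⟩
  have hS₁m : MeasurableSet S₁ := (measurableSet_unitBox _).prod MeasurableSet.univ
  refine setIntegral_eq_of_subset_of_forall_sdiff_eq_zero hS₁m hsub ?_
  rintro ⟨a, k⟩ ⟨hp, hnot⟩
  by_contra hne
  apply hnot
  have hW0 : W (glDiagonal (n + 1) (AdeleRing (𝓞 K) K) τ * torusPoint (n + 1) K (a, k)) ≠ 0 := by
    intro h
    apply hne
    simp only [torusPairIntegrandC, h, zero_mul]
  have hΦ0 : thinTestFun (n + 1) K Φinf T m (lastRow (n + 1) K (torusPoint (n + 1) K (a, k))) ≠ 0 := by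
    intro h
    apply hne
    simp only [torusPairIntegrandC, h, Complex.ofReal_zero, mul_zero, zero_mul]
  -- `diag τ · diag a k = diag(τ a) k`, with the same last row
  rw [← torusPoint_mul] at hW0
  have hrow : lastRow (n + 1) K (torusPoint (n + 1) K (τ * a, k)) = lastRow (n + 1) K (torusPoint (n + 1) K (a, k)) := by
    rw [torusPoint_mul, lastRow_glDiagonal_mul, hτ, Units.val_one, one_smul]
  rw [← hrow] at hΦ0
  refine ⟨fun w _ i => ?_, Set.mem_univ _⟩
  by_cases hw : w ∈ T
  · obtain ⟨t, M, c₀, hWv, hψv, hM₁, hmono, hgap, hmt⟩ := hT w hw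
    have h := valued_eq_one_of_torusIntegrand_thin_ne_zero hWN hWZ hWv hψv hM₁ hmono hgap hm hmt hw (τ * a) k hW0 hΦ0 i
    -- `τ_{i,w} = 1`
    have hτi : ((τ i : ideleGroup K) : AdeleRing (𝓞 K) K).2 w = 1 := by
      have h1 := (Matrix.GeneralLinearGroup.ext_iff _ _).1 (hτT w hw) i i
      rw [AdelicGroupData.coe_map_adeleEval_apply, coe_glDiagonal, Matrix.diagonal_apply_eq, Units.val_one,
        Matrix.one_apply_eq, AdelicGroupData.adeleEval_apply] at h1
      exact h1
    have e : (((τ * a) i : ideleGroup K) : AdeleRing (𝓞 K) K).2 w =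
        (((τ i : ideleGroup K) : AdeleRing (𝓞 K) K).2 w) * (((a i : ideleGroup K) : AdeleRing (𝓞 K) K).2 w) := by
      rw [Pi.mul_apply, Units.val_mul]
      rfl
    rw [e, hτi, one_mul] at h
    exact h
  · exact hp.1 w hw i

end Collapse

/-! ### Small arithmetic -/

section Arith

/-- A product of two `{0, 1}`-valued numbers is `{0, 1}`-valued. [folklore] -/
theorem mul_eq_zero_or_one {a b : ℂ} (ha : a = 0 ∨ a = 1) (hb : b = 0 ∨ b = 1) : a * b = 0 ∨ a * b = 1 := by
  rcases ha with rfl | rfl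
  · exact Or.inl (zero_mul b)
  · rw [one_mul]; exact hb

/-- A finite product of `{0, 1}`-valued numbers is `{0, 1}`-valued. [folklore] -/
theorem prod_eq_zero_or_one {ι : Type*} (s : Finset ι) {f : ι → ℂ} (hf : ∀ i ∈ s, f i = 0 ∨ f i = 1) :
    ∏ i ∈ s, f i = 0 ∨ ∏ i ∈ s, f i = 1 := by
  by_cases h : ∃ i ∈ s, f i = 0
  · obtain ⟨i, hi, h0⟩ := h
    exact Or.inl (Finset.prod_eq_zero hi h0)
  · exact Or.inr (Finset.prod_eq_one fun i hi => (hf i hi).resolve_left fun h0 => h ⟨i, hi, h0⟩)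

variable {K : Type} [Field K]

/-- `∏_{v ∈ T} 𝔭_v^m ≠ 0`. [folklore] -/
theorem prod_pow_asIdeal_ne_zero (T : Finset (HeightOneSpectrum (𝓞 K))) (m : ℕ) :
    (∏ v ∈ T, v.asIdeal ^ m : Ideal (𝓞 K)) ≠ 0 :=
  Finset.prod_ne_zero_iff.2 fun v _ => pow_ne_zero _ v.ne_bot

variable [NumberField K]

/-- `|∏_{w ∈ T} 𝔭_w^m|_v ≤ exp(-m)` for `v ∈ T`. [folklore] -/
theorem idealRadius_prod_pow_le {T : Finset (HeightOneSpectrum (𝓞 K))} (m : ℕ) {v : HeightOneSpectrum (𝓞 K)}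
    (hv : v ∈ T) : idealRadius K v (∏ w ∈ T, w.asIdeal ^ m) ≤ exp (-(m : ℤ)) :=
  (idealRadius_le_of_dvd K v (prod_pow_asIdeal_ne_zero T m) (Finset.dvd_prod_of_mem _ hv)).trans_eq
    (idealRadius_pow_self K v m)

end Arith

/-! ### The registered sub-goal: part (i) of the stub -/

/-- **SUB-GOAL (W4a, part (i)) — the support collapse for the translate**, `∀`-form of
`setIntegral_translate_thin_eq_unitBox_univ`: for `W` left `ψ`-equivariant, central up to modulus one and spread at
every `v ∈ T` (with the depth-`m` inequality), `τ` a torus element with last entry `1` trivial at `T`, and ANY second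
factor `W₂`, the thin pair torus integrand of `(W(diag τ ·), W₂, thinTestFun Φ_∞ T m)` has the same integral over
`B({v ∉ T}) × K` and over `B(all) × K`. [folklore] -/
theorem stub_unitBox_translate_collapse :
    ∀ {n : ℕ} {K : Type} [Field K] [NumberField K]
      [MeasurableSpace (ideleGroup K)] [BorelSpace (ideleGroup K)] [MeasurableSpace (AdelicGroupData.gl (n + 1) K).Adelic]
      {ψ : AddChar (AdeleRing (𝓞 K) K) Circle} {W : GL (Fin (n + 1)) (AdeleRing (𝓞 K) K) → ℂ}
      (_ : ∀ (u : ↥(adelicUnipotent (n + 1) K)) (g : GL (Fin (n + 1)) (AdeleRing (𝓞 K) K)), W ((u : GL (Fin (n + 1)) (AdeleRing (𝓞 K) K)) * g) = whittakerCharFun ψ u * W g)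
      (_ : ∀ (z : ideleGroup K) (g : GL (Fin (n + 1)) (AdeleRing (𝓞 K) K)), ‖W (Matrix.GeneralLinearGroup.scalar (Fin (n + 1)) z * g)‖ = ‖W g‖)
      {T : Finset (HeightOneSpectrum (𝓞 K))} {m : ℕ} (_ : 1 ≤ m)
      (τ : Fin (n + 1) → ideleGroup K) (_ : lastEntry τ = 1) (_ : ∀ v ∈ T, localComponent v (glDiagonal (n + 1) (AdeleRing (𝓞 K) K) τ) = 1)
      (_ : ∀ v ∈ T, ∃ (t : Fin (n + 1) → (v.adicCompletion K)ˣ) (M c₀ : ℤ), IsSpreadWhittakerAt v ψ t M W ∧ (∃ x : v.adicCompletion K, Valued.v x ≤ exp (1 - c₀) ∧ ψ.adicComponent v x ≠ 1) ∧ 1 ≤ M ∧ (∀ i j : Fin (n + 1), i ≤ j → Valued.v (t j : v.adicCompletion K) ≤ Valued.v (t i : v.adicCompletion K)) ∧ (∀ i j : Fin (n + 1), (i : ℕ) + 1 = j → exp (M - c₀) * Valued.v (t j : v.adicCompletion K) ≤ Valued.v (t i : v.adicCompletion K)) ∧ exp (-(m : ℤ)) * Valued.v (t 0 : v.adicCompletion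 K) ≤ exp (-M) * Valued.v (t (Fin.last n) : v.adicCompletion K))
      (W₂ : GL (Fin (n + 1)) (AdeleRing (𝓞 K) K) → ℂ) (Φinf : (Fin (n + 1) → InfiniteAdeleRing K) → ℝ) (s : ℂ)
      (νA : Measure (Fin (n + 1) → ideleGroup K)) (νK : Measure ↥(maximalCompactAdelic (n + 1) K)),
    ∫ p in unitBox {v | v ∉ (↑T : Set (HeightOneSpectrum (𝓞 K)))} ×ˢ Set.univ, torusPairIntegrandC (n + 1) K (fun g => W (glDiagonal (n + 1) (AdeleRing (𝓞 K) K) τ * g)) W₂ (thinTestFun (n + 1) K Φinf T m) s p ∂(νA.prod νK) = ∫ p in unitBox (Set.univ : Set (HeightOneSpectrum (𝓞 K))) ×ˢ Set.univ, torusPairIntegrandC (n + 1) K (fun g => W (glDiagonal (n + 1) (AdeleRing (𝓞 K) K) τ * g)) W₂ (thinTestFun (n + 1) K Φinf T m) s p ∂(νA.prod νK) := by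
  intro n K _ _ _ _ _ ψ W hWN hWZ T m hm τ hτ hτT hT W₂ Φinf s νA νK
  exact setIntegral_translate_thin_eq_unitBox_univ hWN hWZ hm τ hτ hτT hT W₂ Φinf s νA νK

end Summit.Langlands.Langlands.Theorems.UnitBoxTranslateProductForm
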